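import Literature.MathematicalPhysics.QuantumLattice.GrassmannEffectiveActionTruncationDB
import Mathlib.Analysis.SpecificLimits.Normed
import HarnessLib

/-!
# The effective action is LIPSCHITZ in the interaction: pinned `L¹` kernels of `effAction C (V₁ + V₂) − effAction C V₁` are
# `≤ ρ^{-m} · e‖V₂‖_h / (1 − θ)²` for DETERMINANT-BOUNDED covariances (polarised cumulants)

Topic `MathematicalPhysics/QuantumLattice`; continuation of `GrassmannCumulantBoundDB` / `GrassmannEffectiveActionTruncationDB` (the cumulant
series of `effAction C V` under `IsGramBoundedR C κ`: `‖𝓔ᵀ_C(V; n)‖ ≤ n!·ρ^{-m}κ^{-2(n−1)}α^{n−1}eⁿ‖V‖_hⁿ`, Benfatto–Giuliani–Mastropietro 2006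
(2.13)–(2.14) with (2.77)–(2.80)).  The truncated expectations are MULTILINEAR in the vertices (the replica / tree formula
`GrassmannCumulantKernelBound.ursellOf_convMoment_eq_sum_piFinset`), and the tree-expansion bound
`GrassmannTruncatedBoundDB.sum_norm_kernel_ursellOf_kernelVertex_le_of_gramBounded` is stated for ARBITRARY per-copy kernels and profiles.
Hence for two even interactions `V₁, V₂` (pinned profiles `N₁, N₂`, `‖V_s‖_h = Σ_{m'} (e²(κ+ρ))^{2m'} N_s(m')`):

* **`sum_norm_kernel_cumulantOf_add_sub_le_of_gramBounded`** — the POLARISED cumulant bound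
  `Σ_{W : W_i = w} ‖kernel_r (𝓔ᵀ_C(V₁+V₂; n) − 𝓔ᵀ_C(V₁; n)) (W)‖ ≤ n!·ρ^{-r}κ^{-2(n−1)}α^{n−1}eⁿ·((‖V₁‖_h + ‖V₂‖_h)ⁿ − ‖V₁‖_hⁿ)`:
  expanding every copy over the species, the all-`V₁` assignments reproduce `𝓔ᵀ_C(V₁; n)` exactly and every other assignment carries at
  least one `V₂`-profile;
* **`sum_norm_kernel_effAction_add_sub_le_of_gramBounded`** — summing the series, with `θ = eα(‖V₁‖_h + ‖V₂‖_h)/κ² < 1`, in every degree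
  `m ≥ 1`, one output label pinned,
  `Σ_{W : W_i = w} ‖kernel_m (effAction C (V₁ + V₂)) (W) − kernel_m (effAction C V₁) (W)‖ ≤ ρ^{-m} · e‖V₂‖_h / (1 − θ)²`
  (from `(a+b)ⁿ − aⁿ ≤ n b (a+b)^{n−1}` and `Σ_n n θ^{n−1} = (1−θ)^{-2}`): the single-scale map `V ↦ effAction C V` is Lipschitz on the disc
  `θ < 1` in the pinned `L¹` kernel norms, with constant `e/(1−θ)²` against `‖·‖_h` (Gawȩdzki–Kupiainen 1985 §3, BGM 2006 (2.86)–(2.90): the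
  polarised form of the convergence of the cumulant expansion — used when two effective actions with the SAME covariance and nearby
  interactions are compared, e.g. two Matsubara cutoffs after the shell integration, or an interaction defect between two volumes).

Everything is proved; no definition, no named fact.

## Sources

G. Benfatto, A. Giuliani, V. Mastropietro, Ann. Henri Poincaré 7 (2006) 809–898, (2.13)–(2.14), (2.77)–(2.80), (2.86)–(2.90)
[`BenfattoGiulianiMastropietro2006`]; K. Gawȩdzki, A. Kupiainen, Comm. Math. Phys. 102 (1985) 1–30, §3 [`GawedzkiKupiainen1985GrossNeveu`];
W. de Siqueira Pedra, M. Salmhofer, Comm. Math. Phys. 282 (2008) 797–818, Thm 1.3 [`PedraSalmhofer2008`].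
-/

noncomputable section

namespace Literature.MathematicalPhysics.QuantumLattice

open GrassmannAlgebra Finset Literature.Probability.LatticeModels
open scoped InnerProductSpace Nat

universe u

variable {𝕜 : Type*} [RCLike 𝕜] {Γ : Type u} [Fintype Γ] [DecidableEq Γ] {n : ℕ} (C : Matrix Γ Γ 𝕜)

/-! ### Elementary inequalities -/

section Elementary

/-- `(a+b)ⁿ − aⁿ ≤ n·b·(a+b)^{n−1}` for `0 ≤ a, b`. [folklore] -/
private theorem add_pow_sub_pow_le {a b : ℝ} (ha : 0 ≤ a) (hb : 0 ≤ b) (n : ℕ) :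
    (a + b) ^ n - a ^ n ≤ (n : ℝ) * b * (a + b) ^ (n - 1) := by
  have hgeom := geom_sum₂_mul (a + b) a n
  rw [add_sub_cancel_left] at hgeom
  rw [← hgeom]
  have hterm : ∀ i ∈ range n, (a + b) ^ i * a ^ (n - 1 - i) ≤ (a + b) ^ (n - 1) := by
    intro i hi
    have hi' : i ≤ n - 1 := by have := mem_range.1 hi; omega
    calc (a + b) ^ i * a ^ (n - 1 - i) ≤ (a + b) ^ i * (a + b) ^ (n - 1 - i) :=
          mul_le_mul_of_nonneg_left (pow_le_pow_left₀ ha (le_add_of_nonneg_right hb) _) (by positivity)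
      _ = (a + b) ^ (n - 1) := by rw [← pow_add]; congr 1; omega
  calc (∑ i ∈ range n, (a + b) ^ i * a ^ (n - 1 - i)) * b ≤ (∑ _i ∈ range n, (a + b) ^ (n - 1)) * b :=
        mul_le_mul_of_nonneg_right (sum_le_sum hterm) hb
    _ = (n : ℝ) * b * (a + b) ^ (n - 1) := by rw [sum_const, card_range, nsmul_eq_mul]; ring

/-- `Σ_{n < n₀} (n+1) θⁿ ≤ (1−θ)^{-2}` for `0 ≤ θ < 1`. [folklore] -/
private theorem sum_range_succ_mul_pow_le {θ : ℝ} (hθ0 : 0 ≤ θ) (hθ1 : θ < 1) (n₀ : ℕ) :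
    ∑ k ∈ range n₀, ((k : ℝ) + 1) * θ ^ k ≤ 1 / (1 - θ) ^ 2 := by
  have hnorm : ‖θ‖ < 1 := by rw [Real.norm_eq_abs, abs_of_nonneg hθ0]; exact hθ1
  have h1 : HasSum (fun k : ℕ => (k : ℝ) * θ ^ k) (θ / (1 - θ) ^ 2) := hasSum_coe_mul_geometric_of_norm_lt_one hnorm
  have h2 : HasSum (fun k : ℕ => θ ^ k) (1 - θ)⁻¹ := hasSum_geometric_of_lt_one hθ0 hθ1
  have h3 : HasSum (fun k : ℕ => ((k : ℝ) + 1) * θ ^ k) (θ / (1 - θ) ^ 2 + (1 - θ)⁻¹) := by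
    have := h1.add h2
    refine this.congr_fun fun k => ?_
    ring
  have hsum : θ / (1 - θ) ^ 2 + (1 - θ)⁻¹ = 1 / (1 - θ) ^ 2 := by
    have h1θ : (1 - θ) ≠ 0 := by linarith
    field_simp
    ring
  rw [← hsum]
  exact sum_le_hasSum (range n₀) (fun k _ => by positivity) h3

end Elementary

/-! ### The polarised cumulant bound -/

section Polarised

/-- The species-and-degree assignments whose species are all `0` are the degree assignments tagged with `0`. [folklore] -/
private theorem filter_piFinset_fst_eq_zero_eq_map (degs : Finset ℕ) :
    (Fintype.piFinset (fun _ : Fin n => (univ : Finset (Fin 2)) ×ˢ degs)).filter (fun η => ∀ a, (η a).1 = 0) =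
      (Fintype.piFinset (fun _ : Fin n => degs)).map
        ⟨fun δ a => ((0 : Fin 2), δ a), fun _ _ h => funext fun a => congrArg Prod.snd (congrFun h a)⟩ := by
  ext η
  simp only [mem_filter, Fintype.mem_piFinset, mem_product, mem_univ, true_and, mem_map, Function.Embedding.coeFn_mk]
  constructor
  · rintro ⟨hdeg, hsp⟩
    exact ⟨fun a => (η a).2, hdeg, funext fun a => Prod.ext (hsp a).symm rfl⟩
  · rintro ⟨δ, hδ, rfl⟩
    exact ⟨hδ, fun a => rfl⟩

/-- **The POLARISED cumulant bound** (BGM 2006 (2.13)–(2.14) with (2.77)–(2.80), for two species of vertices): for even elements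
`X₀ = Σ_{m' ∈ degs} Σ_Y K₀(m',Y) ψ(Y)`, `X₁ = Σ Σ K₁ ψ` with pinned `L¹` norms `≤ N₀(m')`, `≤ N₁(m')`, a charged covariance replica-Gram-bounded
with constant `κ > 0` and one-copy row and column sums `≤ α`, an output weight `ρ > 0`: one output label pinned and the others summed,
`Σ_{W : W_i = w} ‖kernel_r (𝓔ᵀ_C(X₀+X₁; n) − 𝓔ᵀ_C(X₀; n)) (W)‖ ≤ n!·ρ^{-r}κ^{-2(n−1)}α^{n−1}eⁿ·((A₀ + A₁)ⁿ − A₀ⁿ)`,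
`A_s = Σ_{m' ∈ degs} (e²(κ+ρ))^{2m'} N_s(m')` — every copy is expanded over the two species; the all-`X₀` assignments give `𝓔ᵀ_C(X₀; n)` exactly.
[cite: BenfattoGiulianiMastropietro2006, (2.13)-(2.14) and (2.77)-(2.80)] -/
theorem sum_norm_kernel_cumulantOf_add_sub_le_of_gramBounded {κ : ℝ} (hκ : 0 < κ) (hGB : IsGramBoundedR C κ)
    (degs : Finset ℕ) (Ksp : Fin 2 → (m' : ℕ) → (Fin (2 * m') → Γ) → 𝕜) (Nsp : Fin 2 → ℕ → ℝ) (hN0 : ∀ s m', 0 ≤ Nsp s m')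
    (hN : ∀ s m' (j : Fin (2 * m')) (w : Γ), ∑ Y ∈ univ.filter (fun Y : Fin (2 * m') → Γ => Y j = w), ‖Ksp s m' Y‖ ≤ Nsp s m')
    {α : ℝ} (hα : 0 < α) (hrow : ∀ X, ∑ Y, ‖C X Y‖ ≤ α) (hcol : ∀ Y, ∑ X, ‖C X Y‖ ≤ α) {ρ : ℝ} (hρ : 0 < ρ)
    (hn : 0 < n) {r : ℕ} (i : Fin r) (w : Γ) :
    ∑ W ∈ univ.filter (fun W : Fin r → Γ => W i = w),
        ‖kernel 𝕜 ((cumulantOf (fun k => evenGaussConv 𝕜 C ((vertexOf 𝕜 degs (Ksp 0) + vertexOf 𝕜 degs (Ksp 1)) ^ k)) n :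
            evenPart 𝕜 Γ) : GrassmannAlgebra 𝕜 Γ) r W -
          kernel 𝕜 ((cumulantOf (fun k => evenGaussConv 𝕜 C (vertexOf 𝕜 degs (Ksp 0) ^ k)) n : evenPart 𝕜 Γ) :
            GrassmannAlgebra 𝕜 Γ) r W‖ ≤
      (n.factorial : ℝ) * (ρ⁻¹ ^ r * κ⁻¹ ^ (2 * (n - 1)) * (α ^ (n - 1) * Real.exp n)) *
        ((∑ m' ∈ degs, (Real.exp 2 * (κ + ρ)) ^ (2 * m') * Nsp 0 m' + ∑ m' ∈ degs, (Real.exp 2 * (κ + ρ)) ^ (2 * m') * Nsp 1 m') ^ n -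
          (∑ m' ∈ degs, (Real.exp 2 * (κ + ρ)) ^ (2 * m') * Nsp 0 m') ^ n) := by
  set C' : Matrix (Fin n × Γ) (Fin n × Γ) 𝕜 := C.submatrix Prod.snd Prod.snd with hC'
  have huniv : (univ : Finset (Fin n)).Nonempty := ⟨⟨0, hn⟩, mem_univ _⟩
  have hGB' : IsGramBounded C' κ := by rw [hC']; exact (hGB.submatrix Prod.snd).isGramBounded
  -- the species-and-degree replica families
  set U : (Fin n → Fin 2 × ℕ) → evenPart 𝕜 (Fin n × Γ) := fun η => ursellOf (convMoment 𝕜 C'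
    (kernelVertex 𝕜 (deg := fun b : Fin n => 2 * (η b).2) (fun b => even_two_mul (η b).2)
      fun b => replicaKer 𝕜 (Ksp (η b).1 (η b).2) b)) univ with hU
  set M' : Fin n → Fin 2 × ℕ → evenPart 𝕜 (Fin n × Γ) := fun a sm =>
    kernelVertex 𝕜 (deg := fun _ : Fin n => 2 * sm.2) (fun _ => even_two_mul sm.2) (fun b => replicaKer 𝕜 (Ksp sm.1 sm.2) b) a with hM'
  have hM'mem : ∀ a sm, (M' a sm : GrassmannAlgebra 𝕜 (Fin n × Γ)) ∈ fieldSubalgebra 𝕜 ((Prod.fst : Fin n × Γ → Fin n) ⁻¹' {a}) :=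
    fun a sm => coe_kernelVertex_replicaKer_mem 𝕜 sm.2 (Ksp sm.1 sm.2) a
  set T : Finset (Fin 2 × ℕ) := (univ : Finset (Fin 2)) ×ˢ degs with hT
  -- (1) the full family collapses to `X₀ + X₁`, and expands over all assignments
  have hcollapse : ∀ a, collapseEven 𝕜 (Prod.snd : Fin n × Γ → Γ) (∑ sm ∈ T, M' a sm) =
      vertexOf 𝕜 degs (Ksp 0) + vertexOf 𝕜 degs (Ksp 1) := by
    intro a
    rw [hT, sum_product, Fin.sum_univ_two, map_add]
    have hs : ∀ s : Fin 2, collapseEven 𝕜 (Prod.snd : Fin n × Γ → Γ) (∑ m' ∈ degs, M' a (s, m')) = vertexOf 𝕜 degs (Ksp s) := by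
      intro s
      exact collapseEven_replicaVertex 𝕜 degs (Ksp s) a
    rw [hs 0, hs 1]
  have hcum : ((cumulantOf (fun k => evenGaussConv 𝕜 C ((vertexOf 𝕜 degs (Ksp 0) + vertexOf 𝕜 degs (Ksp 1)) ^ k)) n :
      evenPart 𝕜 Γ) : GrassmannAlgebra 𝕜 Γ) = ∑ η ∈ Fintype.piFinset (fun _ : Fin n => T),
        collapse 𝕜 (Prod.snd : Fin n × Γ → Γ) (U η : GrassmannAlgebra 𝕜 (Fin n × Γ)) := by
    have h1 := collapseEven_ursellOf_convMoment_eq_cumulantOf 𝕜 (Prod.snd : Fin n × Γ → Γ) C (fun a => ∑ sm ∈ T, M' a sm)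
      (vertexOf 𝕜 degs (Ksp 0) + vertexOf 𝕜 degs (Ksp 1)) hcollapse huniv
    rw [card_univ, Fintype.card_fin] at h1
    rw [← h1, coe_collapseEven]
    have h2 : ursellOf (convMoment 𝕜 C' (fun a => ∑ sm ∈ T, M' a sm)) univ = ∑ η ∈ Fintype.piFinset (fun _ : Fin n => T), U η :=
      ursellOf_convMoment_eq_sum_piFinset 𝕜 C' (Prod.fst : Fin n × Γ → Fin n) (fun _ : Fin n => T) M' hM'mem ⟨0, hn⟩
    rw [← hC', h2, AddSubmonoidClass.coe_finsetSum, map_sum]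
  -- (2) the species-`0` family collapses to `X₀`, and expands over the degree assignments
  have hcum0 : ((cumulantOf (fun k => evenGaussConv 𝕜 C (vertexOf 𝕜 degs (Ksp 0) ^ k)) n : evenPart 𝕜 Γ) : GrassmannAlgebra 𝕜 Γ) =
      ∑ δ ∈ Fintype.piFinset (fun _ : Fin n => degs),
        collapse 𝕜 (Prod.snd : Fin n × Γ → Γ) (U (fun a => ((0 : Fin 2), δ a)) : GrassmannAlgebra 𝕜 (Fin n × Γ)) := by
    have h1 := collapseEven_ursellOf_convMoment_eq_cumulantOf 𝕜 (Prod.snd : Fin n × Γ → Γ) C (replicaVertex 𝕜 degs (Ksp 0))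
      (vertexOf 𝕜 degs (Ksp 0)) (collapseEven_replicaVertex 𝕜 degs (Ksp 0)) huniv
    rw [card_univ, Fintype.card_fin] at h1
    rw [← h1, coe_collapseEven]
    have h2 : ursellOf (convMoment 𝕜 C' (replicaVertex 𝕜 degs (Ksp 0))) univ =
        ∑ δ ∈ Fintype.piFinset (fun _ : Fin n => degs), U (fun a => ((0 : Fin 2), δ a)) :=
      ursellOf_convMoment_eq_sum_piFinset 𝕜 C' (Prod.fst : Fin n × Γ → Fin n) (fun _ : Fin n => degs)
        (fun a m' => M' a (0, m')) (fun a m' => hM'mem a (0, m')) ⟨0, hn⟩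
    rw [← hC', h2, AddSubmonoidClass.coe_finsetSum, map_sum]
  -- (3) the difference is the sum over the assignments with at least one species-`1` copy
  set emb : (Fin n → ℕ) ↪ (Fin n → Fin 2 × ℕ) :=
    ⟨fun δ a => ((0 : Fin 2), δ a), fun _ _ h => funext fun a => congrArg Prod.snd (congrFun h a)⟩ with hemb
  have hfilter : (Fintype.piFinset (fun _ : Fin n => T)).filter (fun η => ∀ a, (η a).1 = 0) =
      (Fintype.piFinset (fun _ : Fin n => degs)).map emb := filter_piFinset_fst_eq_zero_eq_map degs
  have hdiff : ∀ W : Fin r → Γ,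
      kernel 𝕜 ((cumulantOf (fun k => evenGaussConv 𝕜 C ((vertexOf 𝕜 degs (Ksp 0) + vertexOf 𝕜 degs (Ksp 1)) ^ k)) n :
          evenPart 𝕜 Γ) : GrassmannAlgebra 𝕜 Γ) r W -
        kernel 𝕜 ((cumulantOf (fun k => evenGaussConv 𝕜 C (vertexOf 𝕜 degs (Ksp 0) ^ k)) n : evenPart 𝕜 Γ) : GrassmannAlgebra 𝕜 Γ) r W =
      ∑ η ∈ (Fintype.piFinset (fun _ : Fin n => T)).filter (fun η => ¬ ∀ a, (η a).1 = 0),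
        kernel 𝕜 (collapse 𝕜 (Prod.snd : Fin n × Γ → Γ) (U η : GrassmannAlgebra 𝕜 (Fin n × Γ))) r W := by
    intro W
    rw [hcum, hcum0, kernel_sum, kernel_sum, ← sum_filter_add_sum_filter_not (Fintype.piFinset (fun _ : Fin n => T))
      (fun η => ∀ a, (η a).1 = 0), hfilter, sum_map]
    simp only [hemb, Function.Embedding.coeFn_mk, add_sub_cancel_left]
  -- (4) the bound per assignment and pinned copy
  set g : Fin 2 × ℕ → ℝ := fun sm => (Real.exp 2 * (κ + ρ)) ^ (2 * sm.2) * Nsp sm.1 sm.2 with hg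
  have hg0 : ∀ sm, 0 ≤ g sm := fun sm => mul_nonneg (by positivity) (hN0 _ _)
  set c : ℝ := ρ⁻¹ ^ r * κ⁻¹ ^ (2 * (n - 1)) * (((n - 1).factorial : ℝ) * α ^ (n - 1) * Real.exp n) with hc
  have hc0 : 0 ≤ c := by positivity
  have hη : ∀ (η : Fin n → Fin 2 × ℕ) (b : Fin n), ∑ W' ∈ univ.filter (fun W' : Fin r → Fin n × Γ => W' i = (b, w)),
      ‖kernel 𝕜 (U η : GrassmannAlgebra 𝕜 (Fin n × Γ)) r W'‖ ≤ c * ∏ a, g (η a) := by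
    intro η b
    set δ : Fin n → ℕ := fun a => (η a).2 with hδ
    have hKs : ∀ (v : Fin n) (Yv : Fin (2 * (η v).2) → Fin n × Γ), replicaKer 𝕜 (Ksp (η v).1 (η v).2) v Yv ≠ 0 → ∀ j, (Yv j).1 = v :=
      fun v Yv h j => replicaKer_support 𝕜 (Ksp (η v).1 (η v).2) v Yv h j
    have hP : 0 ≤ ∏ a, g (η a) := prod_nonneg fun a _ => hg0 _
    by_cases hle : r + 2 * (n - 1) ≤ ∑ a, 2 * (η a).2
    · have hcore := sum_norm_kernel_ursellOf_kernelVertex_le_of_gramBounded C' (Prod.fst : Fin n × Γ → Fin n)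
        (fun b => replicaKer 𝕜 (Ksp (η b).1 (η b).2) b) hκ.le hGB'
        (fun b => even_two_mul (η b).2) hKs (fun u => Nsp (η u).1 (η u).2) (fun u => hN0 _ _)
        (fun u j a' => sum_filter_norm_replicaKer_le (Ksp (η u).1 (η u).2) u (hN (η u).1 (η u).2) j a') hα.le
        (fun ℓ X' => sum_norm_typeRestrict_submatrix_le C hα.le hrow ℓ X') (fun ℓ Y' => sum_norm_typeRestrict_submatrix_le' C hα.le hcol ℓ Y')
        (lam := (α * ((∑ a, (2 * δ a : ℝ)) + n))⁻¹) (by positivity) i (b, w)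
      refine hcore.trans ?_
      have hsumδ : (∑ v, 2 * (η v).2) = ∑ a, 2 * δ a := rfl
      have hA := choose_mul_pow_le (N := ∑ a, 2 * δ a) (r := r) (m := 2 * (n - 1)) hle hκ hρ
      have hTr := treeFactor_choice_le hn δ hα
      have hNprod : 0 ≤ ∏ u, Nsp (η u).1 (η u).2 := prod_nonneg fun u _ => hN0 _ _
      have hTnonneg : 0 ≤ ((α * ((∑ a, (2 * δ a : ℝ)) + n))⁻¹)⁻¹ ^ (n - 1) *
          ∏ ℓ : Sym2 (Fin n), (1 + (α * ((∑ a, (2 * δ a : ℝ)) + n))⁻¹ * (α * (pairDeg (fun a => 2 * δ a) ℓ : ℝ))) := by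
        have hs : 0 ≤ ∑ a, (2 * δ a : ℝ) := sum_nonneg fun a _ => by positivity
        exact mul_nonneg (by positivity) (prod_nonneg fun ℓ _ => by positivity)
      have hpd : (pairDeg (fun b : Fin n => 2 * (η b).2)) = pairDeg (fun a => 2 * δ a) := rfl
      rw [hsumδ, hpd]
      calc ((((r.factorial : ℝ))⁻¹ * ((∑ a, 2 * δ a).descFactorial r : ℝ)) * κ ^ ((∑ a, 2 * δ a) - (r + 2 * (n - 1))) *
              ∏ u, Nsp (η u).1 (η u).2) *
            (((α * ((∑ a, (2 * δ a : ℝ)) + n))⁻¹)⁻¹ ^ (n - 1) *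
              ∏ ℓ : Sym2 (Fin n), (1 + (α * ((∑ a, (2 * δ a : ℝ)) + n))⁻¹ * (α * (pairDeg (fun a => 2 * δ a) ℓ : ℝ))))
          ≤ ((ρ⁻¹ ^ r * κ⁻¹ ^ (2 * (n - 1)) * (κ + ρ) ^ (∑ a, 2 * δ a)) * ∏ u, Nsp (η u).1 (η u).2) *
              (((n - 1).factorial : ℝ) * α ^ (n - 1) * Real.exp (2 * (∑ a, (2 * δ a : ℝ)) + n)) :=
            mul_le_mul (mul_le_mul_of_nonneg_right hA hNprod) hTr hTnonneg (by positivity)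
        _ = c * ∏ a, g (η a) := by
            have hexp : Real.exp (2 * (∑ a, (2 * δ a : ℝ)) + n) = Real.exp n * ∏ a, Real.exp 2 ^ (2 * δ a) := by
              rw [Real.exp_add, mul_comm, mul_sum, Real.exp_sum]
              congr 1
              refine prod_congr rfl fun a _ => ?_
              rw [← Real.exp_nat_mul]
              congr 1
              push_cast
              ring
            rw [hexp, ← prod_pow_eq_pow_sum, hc]
            simp only [hg, hδ, mul_pow, prod_mul_distrib]
            ring
    · refine le_trans (le_of_eq (sum_eq_zero fun W' _ => ?_)) (mul_nonneg hc0 hP)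
      rw [hU]
      dsimp only
      rw [kernel_ursellOf_kernelVertex_eq_zero_of_lt_of_gramBounded C' (Prod.fst : Fin n × Γ → Fin n)
        (fun b => replicaKer 𝕜 (Ksp (η b).1 (η b).2) b) hκ.le hGB'
        (fun b => even_two_mul (η b).2) hKs ⟨0, hn⟩ (not_le.1 hle) W', norm_zero]
  -- (5) the sum of the weights over the assignments with a species-`1` copy
  have hgsum : ∑ η ∈ (Fintype.piFinset (fun _ : Fin n => T)).filter (fun η => ¬ ∀ a, (η a).1 = 0), ∏ a, g (η a) =
      (∑ m' ∈ degs, (Real.exp 2 * (κ + ρ)) ^ (2 * m') * Nsp 0 m' + ∑ m' ∈ degs, (Real.exp 2 * (κ + ρ)) ^ (2 * m') * Nsp 1 m') ^ n -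
        (∑ m' ∈ degs, (Real.exp 2 * (κ + ρ)) ^ (2 * m') * Nsp 0 m') ^ n := by
    have hall : ∑ η ∈ Fintype.piFinset (fun _ : Fin n => T), ∏ a, g (η a) =
        (∑ m' ∈ degs, (Real.exp 2 * (κ + ρ)) ^ (2 * m') * Nsp 0 m' + ∑ m' ∈ degs, (Real.exp 2 * (κ + ρ)) ^ (2 * m') * Nsp 1 m') ^ n := by
      rw [← prod_univ_sum (fun _ : Fin n => T) fun _ sm => g sm, prod_const, card_univ, Fintype.card_fin, hT, sum_product,
        Fin.sum_univ_two]
    have hzero : ∑ η ∈ (Fintype.piFinset (fun _ : Fin n => T)).filter (fun η => ∀ a, (η a).1 = 0), ∏ a, g (η a) =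
        (∑ m' ∈ degs, (Real.exp 2 * (κ + ρ)) ^ (2 * m') * Nsp 0 m') ^ n := by
      rw [hfilter, sum_map, ← sum_piFinset_prod_eq_pow degs fun m' => (Real.exp 2 * (κ + ρ)) ^ (2 * m') * Nsp 0 m']
      simp only [hemb, Function.Embedding.coeFn_mk, hg]
    rw [← sum_filter_add_sum_filter_not (Fintype.piFinset (fun _ : Fin n => T)) (fun η => ∀ a, (η a).1 = 0), hzero] at hall
    linarith
  -- (6) assemble
  calc ∑ W ∈ univ.filter (fun W : Fin r → Γ => W i = w),
        ‖kernel 𝕜 ((cumulantOf (fun k => evenGaussConv 𝕜 C ((vertexOf 𝕜 degs (Ksp 0) + vertexOf 𝕜 degs (Ksp 1)) ^ k)) n :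
            evenPart 𝕜 Γ) : GrassmannAlgebra 𝕜 Γ) r W -
          kernel 𝕜 ((cumulantOf (fun k => evenGaussConv 𝕜 C (vertexOf 𝕜 degs (Ksp 0) ^ k)) n : evenPart 𝕜 Γ) :
            GrassmannAlgebra 𝕜 Γ) r W‖
      = ∑ W ∈ univ.filter (fun W : Fin r → Γ => W i = w),
          ‖∑ η ∈ (Fintype.piFinset (fun _ : Fin n => T)).filter (fun η => ¬ ∀ a, (η a).1 = 0),
            kernel 𝕜 (collapse 𝕜 (Prod.snd : Fin n × Γ → Γ) (U η : GrassmannAlgebra 𝕜 (Fin n × Γ))) r W‖ :=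
        sum_congr rfl fun W _ => by rw [hdiff W]
    _ ≤ ∑ W ∈ univ.filter (fun W : Fin r → Γ => W i = w),
          ∑ η ∈ (Fintype.piFinset (fun _ : Fin n => T)).filter (fun η => ¬ ∀ a, (η a).1 = 0),
            ‖kernel 𝕜 (collapse 𝕜 (Prod.snd : Fin n × Γ → Γ) (U η : GrassmannAlgebra 𝕜 (Fin n × Γ))) r W‖ :=
        sum_le_sum fun W _ => norm_sum_le _ _
    _ = ∑ η ∈ (Fintype.piFinset (fun _ : Fin n => T)).filter (fun η => ¬ ∀ a, (η a).1 = 0),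
          ∑ W ∈ univ.filter (fun W : Fin r → Γ => W i = w),
            ‖kernel 𝕜 (collapse 𝕜 (Prod.snd : Fin n × Γ → Γ) (U η : GrassmannAlgebra 𝕜 (Fin n × Γ))) r W‖ := sum_comm
    _ ≤ ∑ η ∈ (Fintype.piFinset (fun _ : Fin n => T)).filter (fun η => ¬ ∀ a, (η a).1 = 0), ∑ _b : Fin n, c * ∏ a, g (η a) :=
        sum_le_sum fun η _ => (sum_filter_norm_kernel_collapse_le _ i w).trans (sum_le_sum fun b _ => hη η b)
    _ = (n : ℝ) * c * ∑ η ∈ (Fintype.piFinset (fun _ : Fin n => T)).filter (fun η => ¬ ∀ a, (η a).1 = 0), ∏ a, g (η a) := by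
        rw [mul_sum]
        exact sum_congr rfl fun η _ => by rw [sum_const, card_univ, Fintype.card_fin, nsmul_eq_mul]; ring
    _ = (n.factorial : ℝ) * (ρ⁻¹ ^ r * κ⁻¹ ^ (2 * (n - 1)) * (α ^ (n - 1) * Real.exp n)) *
        ((∑ m' ∈ degs, (Real.exp 2 * (κ + ρ)) ^ (2 * m') * Nsp 0 m' + ∑ m' ∈ degs, (Real.exp 2 * (κ + ρ)) ^ (2 * m') * Nsp 1 m') ^ n -
          (∑ m' ∈ degs, (Real.exp 2 * (κ + ρ)) ^ (2 * m') * Nsp 0 m') ^ n) := by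
        rw [hgsum, hc, ← Nat.mul_factorial_pred (Nat.pos_iff_ne_zero.1 hn), Nat.cast_mul]
        ring

end Polarised

/-! ### The Lipschitz bound for the effective action -/

section Lipschitz

/-- **THE EFFECTIVE ACTION IS LIPSCHITZ IN THE INTERACTION** (BGM 2006 (2.13)–(2.14), (2.77)–(2.80), (2.86)–(2.90); Gawȩdzki–Kupiainen
1985 §3; the polarised form of `GrassmannEffectiveActionTruncationDB`): charged covariance replica-Gram-bounded with constant `κ`, row/column
sums `≤ α`, output weight `ρ`, two even interactions `V₁, V₂` without constant part with pinned profiles `N₁, N₂`, and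
`θ = eα(‖V₁‖_h + ‖V₂‖_h)/κ² < 1`; then both partition functions are units and in every degree `m ≥ 1`, one output label pinned,
`Σ_{W : W_i = w} ‖kernel_m (effAction C (V₁ + V₂)) (W) − kernel_m (effAction C V₁) (W)‖ ≤ ρ^{-m} · e‖V₂‖_h / (1 − θ)²`.
[cite: BenfattoGiulianiMastropietro2006, (2.13)-(2.14) and (2.86)-(2.90)] -/
theorem sum_norm_kernel_effAction_add_sub_le_of_gramBounded {κ : ℝ} (hκ : 0 < κ) (hGB : IsGramBoundedR C κ)
    (V₁ V₂ : GrassmannAlgebra 𝕜 Γ) (hV₁ : V₁ ∈ evenPart 𝕜 Γ) (hV₂ : V₂ ∈ evenPart 𝕜 Γ)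
    (hV₁0 : constPart 𝕜 V₁ = 0) (hV₂0 : constPart 𝕜 V₂ = 0) (N₁ N₂ : ℕ → ℝ) (hN₁0 : ∀ m', 0 ≤ N₁ m') (hN₂0 : ∀ m', 0 ≤ N₂ m')
    (hN₁ : ∀ m' (j : Fin (2 * m')) (w : Γ), ∑ Y ∈ univ.filter (fun Y : Fin (2 * m') → Γ => Y j = w), ‖kernel 𝕜 V₁ (2 * m') Y‖ ≤ N₁ m')
    (hN₂ : ∀ m' (j : Fin (2 * m')) (w : Γ), ∑ Y ∈ univ.filter (fun Y : Fin (2 * m') → Γ => Y j = w), ‖kernel 𝕜 V₂ (2 * m') Y‖ ≤ N₂ m')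
    {α : ℝ} (hα : 0 < α) (hrow : ∀ X, ∑ Y, ‖C X Y‖ ≤ α) (hcol : ∀ Y, ∑ X, ‖C X Y‖ ≤ α) {ρ : ℝ} (hρ : 0 < ρ)
    (hθ : Real.exp 1 * α * (normV Γ κ ρ N₁ + normV Γ κ ρ N₂) / κ ^ 2 < 1) :
    IsUnit (effPartitionFn 𝕜 C V₁) ∧ IsUnit (effPartitionFn 𝕜 C (V₁ + V₂)) ∧ ∀ {m : ℕ}, 0 < m → ∀ (i : Fin m) (w : Γ),
      ∑ W ∈ univ.filter (fun W : Fin m → Γ => W i = w),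
        ‖kernel 𝕜 (effAction 𝕜 C (V₁ + V₂)) m W - kernel 𝕜 (effAction 𝕜 C V₁) m W‖ ≤
        ρ⁻¹ ^ m * (Real.exp 1 * normV Γ κ ρ N₂) / (1 - Real.exp 1 * α * (normV Γ κ ρ N₁ + normV Γ κ ρ N₂) / κ ^ 2) ^ 2 := by
  -- notation
  set degs : Finset ℕ := range (Fintype.card Γ / 2 + 1) with hdegs
  set a : ℝ := normV Γ κ ρ N₁ with ha
  set b : ℝ := normV Γ κ ρ N₂ with hb
  set θ : ℝ := Real.exp 1 * α * (a + b) / κ ^ 2 with hθdef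
  have ha0 : 0 ≤ a := normV_nonneg hκ.le hρ.le hN₁0
  have hb0 : 0 ≤ b := normV_nonneg hκ.le hρ.le hN₂0
  have hθ0 : 0 ≤ θ := by positivity
  have hθ1 : θ < 1 := hθ
  have hexpn : ∀ k : ℕ, Real.exp k = Real.exp 1 ^ k := fun k => by rw [← Real.exp_nat_mul, mul_one]
  -- the profile of the sum
  have hV₁₂ : V₁ + V₂ ∈ evenPart 𝕜 Γ := add_mem hV₁ hV₂
  have hV₁₂0 : constPart 𝕜 (V₁ + V₂) = 0 := by rw [map_add, hV₁0, hV₂0, add_zero]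
  have hN₁₂ : ∀ m' (j : Fin (2 * m')) (w : Γ), ∑ Y ∈ univ.filter (fun Y : Fin (2 * m') → Γ => Y j = w),
      ‖kernel 𝕜 (V₁ + V₂) (2 * m') Y‖ ≤ (fun m' => N₁ m' + N₂ m') m' := by
    intro m' j w
    calc ∑ Y ∈ univ.filter (fun Y : Fin (2 * m') → Γ => Y j = w), ‖kernel 𝕜 (V₁ + V₂) (2 * m') Y‖
        ≤ ∑ Y ∈ univ.filter (fun Y : Fin (2 * m') → Γ => Y j = w), (‖kernel 𝕜 V₁ (2 * m') Y‖ + ‖kernel 𝕜 V₂ (2 * m') Y‖) :=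
          sum_le_sum fun Y _ => by rw [kernel_add]; exact norm_add_le _ _
      _ ≤ N₁ m' + N₂ m' := by rw [sum_add_distrib]; exact add_le_add (hN₁ m' j w) (hN₂ m' j w)
  have hnV₁₂ : normV Γ κ ρ (fun m' => N₁ m' + N₂ m') = a + b := by
    rw [ha, hb, normV, normV, normV, ← sum_add_distrib]
    exact sum_congr rfl fun m' _ => by ring
  have hθ₁ : Real.exp 1 * α * normV Γ κ ρ N₁ / κ ^ 2 < 1 := by
    refine lt_of_le_of_lt ?_ hθ
    exact div_le_div_of_nonneg_right (mul_le_mul_of_nonneg_left (le_add_of_nonneg_right hb0) (by positivity)) (by positivity)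
  have hθ₁₂ : Real.exp 1 * α * normV Γ κ ρ (fun m' => N₁ m' + N₂ m') / κ ^ 2 < 1 := by rw [hnV₁₂]; exact hθ
  -- the two truncation theorems (units and the tails of the cumulant series)
  have hT₁ := fun n₀ (hn₀ : 0 < n₀) => sum_norm_kernel_effAction_add_sum_cumulant_le_of_gramBounded C hκ hGB V₁ hV₁ hV₁0 N₁ hN₁0 hN₁ hα
    hrow hcol hρ hθ₁ hn₀
  have hT₁₂ := fun n₀ (hn₀ : 0 < n₀) => sum_norm_kernel_effAction_add_sum_cumulant_le_of_gramBounded C hκ hGB (V₁ + V₂) hV₁₂ hV₁₂0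
    (fun m' => N₁ m' + N₂ m') (fun m' => add_nonneg (hN₁0 m') (hN₂0 m')) hN₁₂ hα hrow hcol hρ hθ₁₂ hn₀
  refine ⟨(hT₁ 1 one_pos).1, (hT₁₂ 1 one_pos).1, @fun m hm i w => ?_⟩
  -- the kernels of `-V₁`, `-V₂` as `vertexOf`
  set X₁ : evenPart 𝕜 Γ := ⟨-V₁, neg_mem hV₁⟩ with hX₁
  set X₂ : evenPart 𝕜 Γ := ⟨-V₂, neg_mem hV₂⟩ with hX₂
  set X₁₂ : evenPart 𝕜 Γ := ⟨-(V₁ + V₂), neg_mem hV₁₂⟩ with hX₁₂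
  set Ksp : Fin 2 → (m' : ℕ) → (Fin (2 * m') → Γ) → 𝕜 := fun s m' =>
    if s = 0 then kernel 𝕜 (-V₁) (2 * m') else kernel 𝕜 (-V₂) (2 * m') with hKsp
  have hXv₁ : vertexOf 𝕜 degs (Ksp 0) = X₁ := Subtype.ext (coe_vertexOf_kernel_eq 𝕜 X₁)
  have hXv₂ : vertexOf 𝕜 degs (Ksp 1) = X₂ := Subtype.ext (coe_vertexOf_kernel_eq 𝕜 X₂)
  have hX₁₂eq : X₁ + X₂ = X₁₂ := Subtype.ext (by change -V₁ + -V₂ = -(V₁ + V₂); rw [neg_add])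
  set Nsp : Fin 2 → ℕ → ℝ := fun s => if s = 0 then N₁ else N₂ with hNsp
  have hNsp0 : ∀ s m', 0 ≤ Nsp s m' := by
    intro s m'; simp only [hNsp]; split_ifs; exacts [hN₁0 m', hN₂0 m']
  have hKnorm : ∀ (V : GrassmannAlgebra 𝕜 Γ) (m' : ℕ) (Y : Fin (2 * m') → Γ), ‖kernel 𝕜 (-V) (2 * m') Y‖ = ‖kernel 𝕜 V (2 * m') Y‖ := by
    intro V m' Y
    rw [show -V = (-1 : 𝕜) • V from (neg_one_smul 𝕜 V).symm, kernel_smul, norm_mul, norm_neg, norm_one, one_mul]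
  have hNspB : ∀ s m' (j : Fin (2 * m')) (w : Γ), ∑ Y ∈ univ.filter (fun Y : Fin (2 * m') → Γ => Y j = w), ‖Ksp s m' Y‖ ≤ Nsp s m' := by
    intro s m' j w
    simp only [hKsp, hNsp]
    split_ifs
    · simp only [hKnorm]; exact hN₁ m' j w
    · simp only [hKnorm]; exact hN₂ m' j w
  have hA₀ : ∑ m' ∈ degs, (Real.exp 2 * (κ + ρ)) ^ (2 * m') * Nsp 0 m' = a := by simp only [hNsp, if_pos rfl]; rfl
  have hA₁ : ∑ m' ∈ degs, (Real.exp 2 * (κ + ρ)) ^ (2 * m') * Nsp 1 m' = b := by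
    simp only [hNsp, if_neg (show (1 : Fin 2) ≠ 0 by decide)]; rfl
  -- the cumulants
  set κ₁ : ℕ → evenPart 𝕜 Γ := fun n => cumulantOf (fun k => evenGaussConv 𝕜 C (X₁ ^ k)) n with hκ₁
  set κ₁₂ : ℕ → evenPart 𝕜 Γ := fun n => cumulantOf (fun k => evenGaussConv 𝕜 C (X₁₂ ^ k)) n with hκ₁₂
  -- the polarised bound per order
  have hbd : ∀ {n : ℕ}, 0 < n → ∑ W ∈ univ.filter (fun W : Fin m → Γ => W i = w),
      ‖kernel 𝕜 ((κ₁₂ n : evenPart 𝕜 Γ) : GrassmannAlgebra 𝕜 Γ) m W - kernel 𝕜 ((κ₁ n : evenPart 𝕜 Γ) : GrassmannAlgebra 𝕜 Γ) m W‖ ≤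
        (n ! : ℝ) * (ρ⁻¹ ^ m * (Real.exp 1 * b) * ((n : ℝ) * θ ^ (n - 1))) := by
    intro n hn
    have h := sum_norm_kernel_cumulantOf_add_sub_le_of_gramBounded C hκ hGB degs Ksp Nsp hNsp0 hNspB hα hrow hcol hρ hn i w
    rw [hXv₁, hXv₂, hX₁₂eq, hA₀, hA₁] at h
    refine h.trans ?_
    have hpow := add_pow_sub_pow_le ha0 hb0 n
    obtain ⟨n', rfl⟩ : ∃ n', n = n' + 1 := ⟨n - 1, by omega⟩
    rw [Nat.add_sub_cancel] at hpow h ⊢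
    have hc0 : 0 ≤ (((n' + 1).factorial : ℝ)) * (ρ⁻¹ ^ m * κ⁻¹ ^ (2 * n') * (α ^ n' * Real.exp (((n' + 1 : ℕ) : ℝ)))) := by positivity
    refine (mul_le_mul_of_nonneg_left hpow hc0).trans (le_of_eq ?_)
    rw [hθdef, hexpn, div_pow, mul_pow, mul_pow, pow_succ (Real.exp 1) n']
    simp only [inv_pow]
    have hκ2 : κ ^ 2 ≠ 0 := by positivity
    have hκpow : κ ^ (2 * n') ≠ 0 := by positivity
    have hρpow : ρ ^ m ≠ 0 := by positivity
    field_simp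
    ring
  -- for every truncation order: the two tails and the polarised partial sum
  have hmain : ∀ n₀ : ℕ, 0 < n₀ → ∑ W ∈ univ.filter (fun W : Fin m → Γ => W i = w),
      ‖kernel 𝕜 (effAction 𝕜 C (V₁ + V₂)) m W - kernel 𝕜 (effAction 𝕜 C V₁) m W‖ ≤
        ρ⁻¹ ^ m * (Real.exp 1 * b) / (1 - θ) ^ 2 +
          (ρ⁻¹ ^ m * (Real.exp 1 * (a + b)) * θ ^ (n₀ - 1) / (1 - θ) + ρ⁻¹ ^ m * (Real.exp 1 * a) *
            (Real.exp 1 * α * a / κ ^ 2) ^ (n₀ - 1) / (1 - Real.exp 1 * α * a / κ ^ 2)) := by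
    intro n₀ hn₀
    have h₁ := (hT₁ n₀ hn₀).2 hm i w
    have h₁₂ := (hT₁₂ n₀ hn₀).2 hm i w
    rw [hnV₁₂] at h₁₂
    -- the partial sums
    set S₁ : (Fin m → Γ) → 𝕜 := fun W => ∑ n ∈ Ico 1 n₀, ((n ! : 𝕜))⁻¹ *
      kernel 𝕜 ((κ₁ n : evenPart 𝕜 Γ) : GrassmannAlgebra 𝕜 Γ) m W with hS₁
    set S₁₂ : (Fin m → Γ) → 𝕜 := fun W => ∑ n ∈ Ico 1 n₀, ((n ! : 𝕜))⁻¹ *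
      kernel 𝕜 ((κ₁₂ n : evenPart 𝕜 Γ) : GrassmannAlgebra 𝕜 Γ) m W with hS₁₂
    have hsplitW : ∀ W, kernel 𝕜 (effAction 𝕜 C (V₁ + V₂)) m W - kernel 𝕜 (effAction 𝕜 C V₁) m W =
        (kernel 𝕜 (effAction 𝕜 C (V₁ + V₂)) m W + S₁₂ W) - (kernel 𝕜 (effAction 𝕜 C V₁) m W + S₁ W) - (S₁₂ W - S₁ W) := fun W => by ring
    have hpartial : ∑ W ∈ univ.filter (fun W : Fin m → Γ => W i = w), ‖S₁₂ W - S₁ W‖ ≤ ρ⁻¹ ^ m * (Real.exp 1 * b) / (1 - θ) ^ 2 := by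
      have hSdiff : ∀ W, S₁₂ W - S₁ W = ∑ n ∈ Ico 1 n₀, ((n ! : 𝕜))⁻¹ *
          (kernel 𝕜 ((κ₁₂ n : evenPart 𝕜 Γ) : GrassmannAlgebra 𝕜 Γ) m W - kernel 𝕜 ((κ₁ n : evenPart 𝕜 Γ) : GrassmannAlgebra 𝕜 Γ) m W) := by
        intro W
        rw [hS₁₂, hS₁]
        dsimp only
        rw [← sum_sub_distrib]
        exact sum_congr rfl fun n _ => by ring
      calc ∑ W ∈ univ.filter (fun W : Fin m → Γ => W i = w), ‖S₁₂ W - S₁ W‖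
          ≤ ∑ W ∈ univ.filter (fun W : Fin m → Γ => W i = w), ∑ n ∈ Ico 1 n₀, (n ! : ℝ)⁻¹ *
              ‖kernel 𝕜 ((κ₁₂ n : evenPart 𝕜 Γ) : GrassmannAlgebra 𝕜 Γ) m W - kernel 𝕜 ((κ₁ n : evenPart 𝕜 Γ) : GrassmannAlgebra 𝕜 Γ) m W‖ := by
            refine sum_le_sum fun W _ => ?_
            rw [hSdiff W]
            refine (norm_sum_le _ _).trans (le_of_eq (sum_congr rfl fun n _ => ?_))
            rw [norm_mul, norm_inv, RCLike.norm_natCast]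
        _ = ∑ n ∈ Ico 1 n₀, (n ! : ℝ)⁻¹ * ∑ W ∈ univ.filter (fun W : Fin m → Γ => W i = w),
              ‖kernel 𝕜 ((κ₁₂ n : evenPart 𝕜 Γ) : GrassmannAlgebra 𝕜 Γ) m W - kernel 𝕜 ((κ₁ n : evenPart 𝕜 Γ) : GrassmannAlgebra 𝕜 Γ) m W‖ := by
            rw [sum_comm]; exact sum_congr rfl fun n _ => by rw [mul_sum]
        _ ≤ ∑ n ∈ Ico 1 n₀, (n ! : ℝ)⁻¹ * ((n ! : ℝ) * (ρ⁻¹ ^ m * (Real.exp 1 * b) * ((n : ℝ) * θ ^ (n - 1)))) :=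
            sum_le_sum fun n hn => mul_le_mul_of_nonneg_left (hbd (mem_Ico.1 hn).1) (by positivity)
        _ = ρ⁻¹ ^ m * (Real.exp 1 * b) * ∑ n ∈ Ico 1 n₀, (n : ℝ) * θ ^ (n - 1) := by
            rw [mul_sum]
            refine sum_congr rfl fun n _ => ?_
            have hfact : (n ! : ℝ) ≠ 0 := by positivity
            field_simp
        _ ≤ ρ⁻¹ ^ m * (Real.exp 1 * b) * (1 / (1 - θ) ^ 2) := by
            refine mul_le_mul_of_nonneg_left ?_ (by positivity)
            have hshift : ∑ n ∈ Ico 1 n₀, (n : ℝ) * θ ^ (n - 1) = ∑ k ∈ range (n₀ - 1), ((k : ℝ) + 1) * θ ^ k := by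
              rcases n₀ with _ | n₀
              · simp
              · rw [Nat.add_sub_cancel, sum_Ico_eq_sum_range]
                refine sum_congr (by simp) fun k _ => ?_
                push_cast
                rw [show 1 + k - 1 = k by omega]
                ring
            rw [hshift]
            exact sum_range_succ_mul_pow_le hθ0 hθ1 _
        _ = ρ⁻¹ ^ m * (Real.exp 1 * b) / (1 - θ) ^ 2 := by ring
    calc ∑ W ∈ univ.filter (fun W : Fin m → Γ => W i = w), ‖kernel 𝕜 (effAction 𝕜 C (V₁ + V₂)) m W - kernel 𝕜 (effAction 𝕜 C V₁) m W‖
        ≤ ∑ W ∈ univ.filter (fun W : Fin m → Γ => W i = w),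
            (‖S₁₂ W - S₁ W‖ + (‖kernel 𝕜 (effAction 𝕜 C (V₁ + V₂)) m W + S₁₂ W‖ + ‖kernel 𝕜 (effAction 𝕜 C V₁) m W + S₁ W‖)) := by
          refine sum_le_sum fun W _ => ?_
          rw [hsplitW W]
          refine (norm_sub_le _ _).trans ?_
          have h := norm_sub_le (kernel 𝕜 (effAction 𝕜 C (V₁ + V₂)) m W + S₁₂ W) (kernel 𝕜 (effAction 𝕜 C V₁) m W + S₁ W)
          linarith
      _ = ∑ W ∈ univ.filter (fun W : Fin m → Γ => W i = w), ‖S₁₂ W - S₁ W‖ +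
            (∑ W ∈ univ.filter (fun W : Fin m → Γ => W i = w), ‖kernel 𝕜 (effAction 𝕜 C (V₁ + V₂)) m W + S₁₂ W‖ +
              ∑ W ∈ univ.filter (fun W : Fin m → Γ => W i = w), ‖kernel 𝕜 (effAction 𝕜 C V₁) m W + S₁ W‖) := by
          rw [sum_add_distrib, sum_add_distrib]
      _ ≤ ρ⁻¹ ^ m * (Real.exp 1 * b) / (1 - θ) ^ 2 +
            (ρ⁻¹ ^ m * (Real.exp 1 * (a + b)) * θ ^ (n₀ - 1) / (1 - θ) + ρ⁻¹ ^ m * (Real.exp 1 * a) *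
              (Real.exp 1 * α * a / κ ^ 2) ^ (n₀ - 1) / (1 - Real.exp 1 * α * a / κ ^ 2)) :=
          add_le_add hpartial (add_le_add h₁₂ h₁)
  -- let the truncation order tend to infinity
  have hθa0 : 0 ≤ Real.exp 1 * α * a / κ ^ 2 := by positivity
  have hθa1 : Real.exp 1 * α * a / κ ^ 2 < 1 := hθ₁
  have htail : Filter.Tendsto (fun n₀ : ℕ => ρ⁻¹ ^ m * (Real.exp 1 * (a + b)) * θ ^ (n₀ - 1) / (1 - θ) +
      ρ⁻¹ ^ m * (Real.exp 1 * a) * (Real.exp 1 * α * a / κ ^ 2) ^ (n₀ - 1) / (1 - Real.exp 1 * α * a / κ ^ 2))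
      Filter.atTop (nhds 0) := by
    have hsub : Filter.Tendsto (fun n₀ : ℕ => n₀ - 1) Filter.atTop Filter.atTop := Filter.tendsto_sub_atTop_nat 1
    have h1 : Filter.Tendsto (fun n₀ : ℕ => θ ^ (n₀ - 1)) Filter.atTop (nhds 0) :=
      (tendsto_pow_atTop_nhds_zero_of_lt_one hθ0 hθ1).comp hsub
    have h2 : Filter.Tendsto (fun n₀ : ℕ => (Real.exp 1 * α * a / κ ^ 2) ^ (n₀ - 1)) Filter.atTop (nhds 0) :=
      (tendsto_pow_atTop_nhds_zero_of_lt_one hθa0 hθa1).comp hsub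
    have h1' := ((h1.const_mul (ρ⁻¹ ^ m * (Real.exp 1 * (a + b)))).div_const (1 - θ))
    have h2' := ((h2.const_mul (ρ⁻¹ ^ m * (Real.exp 1 * a))).div_const (1 - Real.exp 1 * α * a / κ ^ 2))
    simpa using h1'.add h2'
  have hlim := htail.const_add (ρ⁻¹ ^ m * (Real.exp 1 * b) / (1 - θ) ^ 2)
  rw [add_zero] at hlim
  exact ge_of_tendsto hlim (Filter.eventually_atTop.2 ⟨1, fun n₀ hn₀ => hmain n₀ hn₀⟩)

end Lipschitz

end Literature.MathematicalPhysics.QuantumLattice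

end
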